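import Summits.QuantumFields.YangMills.Theorems.FluctuationComparisonRegPrIntLS1aCentreLegOccurrence
import Literature.MathematicalPhysics.QuantumFieldTheory.Balaban1983to89.BlockAveragingEMLLinearisedBackground
import HarnessLib

/-!
# Route `UnitScaleTilt`, crux K1b-INT `FluctuationComparisonRegPrIntL` (stmt-QuantumFields-20520) — S1aᴴ `RunClassMembershipH`, conjuncts (a)∕(c):
# THE CENTRE-LEG RESPONSE OF BAŁABAN'S (0.4) BLOCK AVERAGE — to first order the average `Ū(c)` responds to a perturbation of the centre leg
# `⟨emb c₋, ν⟩` by a SCALAR multiple `(s′∕|I|)·(g − 1)` of it, with the printed remainder of [Balaban1985Averaging] Prop. 3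

Cell `ym3-torus` (rung R3: SU(2) YM₃ on T³ — NOT d = 4, NOT infinite volume, NOT a mass gap, NOT Clay), width seat `ym3-torus-px13` g24
(helper on the crux, `--supports stmt-QuantumFields-20520`, def-free).  FILE B of the pair; FILE A = `…S1aCentreLegOccurrence` (the walk facts).

THE PRINT.  T. Bałaban, *Averaging operations for lattice gauge theories*, Commun. Math. Phys. **98** (1985) 17–51 [Balaban1985Averaging],
Prop. 3 (122)–(124) p. 36: «Q(V₀, A, c) = L(Q(V₀)A)_c + C(V₀, A, c) … |C(V₀, A, c)| ≦ C₁L²|A|²» — in the tree, at a small-field background and for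
the symmetric (0.4) averaging of [Balaban1987RG1] with the printed `exp[mean log]` on `SU(N)`, this is
✓`BlockAveragingEMLLinearisedBackground.norm_avgFun_ratio_sub_one_sub_covLinAvg_le` (ym-ust-19200-p2): `‖Ū(c)Ū₀(c)* − 1 − (Q₁(U₀)Y)(c)‖ ≤
400·ℓδ·(ℓδ + α)` with `Q₁(U₀)Y = covLinAvg U₀ Y` the mean over the (0.4) index set of the COVARIANT signed sums of `Y` along the loop words plus the
one along the line of `c`.

WHAT THIS FILE PROVES (theorems only; `Params` arbitrary in the standing range; `SU(N)` for every finite non-empty `N`):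
* §1 `covWalkSum_eq_zero_of_forall_bond_ne`; ★ `covWalkSum_loopWord_centreLeg` — for `Y` supported on the centre leg the covariant sum along
  the loop word of member `i` is `Y(e′)` if `(stairWord σ_i n_i).head? = some (ν, true)` and `0` otherwise (FILE A: the centre leg is then the
  FIRST step, forward, with EMPTY prefix — no background transport); `covWalkSum_line_centreLeg = 0`; ★★ `covLinAvg_centreLeg` —
  `(Q₁(U₀)Y)(c) = (|I|⁻¹·s′)•Y(e′)`, `s′` = the number of such members.
* §2 `pertVar_update_mul`; ★★★ `centreLeg_response` — for a background `U₀` with loop variables at `c` within `α ≤ 1∕24` of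
  `1`, `U = U₀` off `e′`, `U(e′) = g·U₀(e′)`, `‖g − 1‖ ≤ δ`, `48ℓδ ≤ 1`, `2ℓδ + α < δ_N` (`ℓ = (d+2)L`):
  `‖Ū(c)·Ū₀(c)* − 1 − (|I|⁻¹·s′)•(g − 1)‖ ≤ 400·ℓδ·(ℓδ + α)` — ONE specialisation of the landed Prop. 3; `s′ ≥ 1` by FILE A's
  `one_le_card_centreLeg`.
USE (successor-sized, not here): the same letter at the moved background (loop variables within `α + dist1 g`, FILE A's
`dist1_loopHol_update_centreLeg_le`) makes `g ↦ Ū(c)` approximately linear with the scalar `s′∕|I|` in the `mlog` chart ⇒ robust local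
surjectivity of the centre-leg law ⇒ with the private laws' (FIB) of ✓`…OneStepSubmersion`: (T⊥) (ii)+(iii) at small fields by bookkeeping.

HONEST SCOPE.  A specialisation by name of a landed expansion plus finite sums; nothing of Bałaban's analysis beyond what the cited tree theorem
certifies; (T⊥), S1aᴴ, the five registered stubs, crux 20520 and `YM3TorusSU2` are NOT proved; the Yang–Mills mass gap is NOT proved.
-/

set_option autoImplicit false

noncomputable section

open scoped Matrix.Norms.L2Operator

namespace Summit.QuantumFields.YangMills.Theorems.FluctuationComparisonRegPrIntLS1aCentreLegResponse

open Literature.MathematicalPhysics.QuantumFieldTheory.Balaban1983to89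
open T4Continuum AveragingRT BlockAveraging
open Summit.QuantumFields.YangMills.Theorems.FluctuationComparisonRegPrIntLS1aCentreLegOccurrence

/-! ## §1 Covariant sums of a perturbation supported on the centre leg -/

section CovSums

open BlockAveragingEMLLinearised BlockAveragingEMLLinearisedBackground

variable {n : Type*} [Fintype n] [DecidableEq n] {P : Params} {j : ℕ}

/-- A covariant signed sum along steps none of which is the bond `e` vanishes for a bond field supported on `e`. [folklore] -/
theorem covWalkSum_eq_zero_of_forall_bond_ne (U₀ : GaugeField P j (Matrix.specialUnitaryGroup n ℂ))
    {Y : PBond P j → Matrix n n ℂ} {e : PBond P j} (hY : ∀ b, b ≠ e → Y b = 0) :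
    ∀ γ : List (LStep P j), (∀ s ∈ γ, s.bond ≠ e) → covWalkSum U₀ Y γ = 0
  | [], _ => rfl
  | s :: γ, h => by
    rw [covWalkSum_cons, covWalkSum_eq_zero_of_forall_bond_ne U₀ hY γ fun t ht => h t (List.mem_cons_of_mem _ ht)]
    have : covStep U₀ Y s = 0 := by
      unfold covStep
      rw [hY s.bond (h s List.mem_cons_self)]
      simp
    rw [this]; simp

/-- **THE COVARIANT SIGNED SUM ALONG A LOOP WORD OF A FIELD SUPPORTED ON THE CENTRE LEG** is `Y(⟨emb c₋, ν⟩)` for the members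
whose staircase starts with `+e_ν` (the centre leg is their first step, with EMPTY prefix transport) and `0` for all others. [folklore] -/
theorem covWalkSum_loopWord_centreLeg (hj : j + 1 ≤ P.m + P.K) (U₀ : GaugeField P j (Matrix.specialUnitaryGroup n ℂ))
    (c : PBond P (j + 1)) {ν : Fin P.d} (hν : ν ≠ c.dir) {Y : PBond P j → Matrix n n ℂ}
    (hY : ∀ b, b ≠ ⟨emb c.src, ν⟩ → Y b = 0) (i : Idx P) :
    covWalkSum U₀ Y (walk (emb c.src) (loopWord P.L c.dir (off i.1) i.2.1 i.2.2)) =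
      if (stairWord i.2.1 (off i.1)).head? = some (ν, true) then Y ⟨emb c.src, ν⟩ else 0 := by
  classical
  obtain ⟨l₀, w', hw⟩ := List.exists_cons_of_ne_nil (loopWord_ne_nil c i)
  have hhead : (stairWord i.2.1 (off i.1)).head? = some (ν, true) ↔ l₀ = (ν, true) := by
    rw [← loopWord_head_eq_iff c i hν, hw, List.head?_cons, Option.some.injEq]
  have htail : ∀ x, (∀ s ∈ walk x w', s.bond ≠ (⟨emb c.src, ν⟩ : PBond P j)) → covWalkSum U₀ Y (walk x w') = 0 :=
    fun x hx => covWalkSum_eq_zero_of_forall_bond_ne U₀ hY _ hx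
  rw [hw]
  obtain ⟨a, b⟩ := l₀
  cases b
  · have hne : (⟨(emb c.src).unshift a, a⟩ : PBond P j) ≠ ⟨emb c.src, ν⟩ := by
      intro h
      have h1 : a = ν := (PBond.mk.injEq _ _ _ _ ▸ h :).2
      subst h1
      exact unshift_emb_ne hj c.src a ((PBond.mk.injEq _ _ _ _ ▸ h :).1)
    have hif : ¬ (stairWord i.2.1 (off i.1)).head? = some (ν, true) := by rw [hhead]; simp
    rw [if_neg hif]
    simp only [walk, covWalkSum_cons]
    rw [(htail _ fun s hs => bond_ne_centreLeg_of_mem_walk_tail hj c i hν hw (by simp [walkEnd]) s hs)]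
    have : covStep U₀ Y ⟨⟨(emb c.src).unshift a, a⟩, false⟩ = 0 := by
      unfold covStep; rw [hY _ hne]; simp
    rw [this]; simp
  · simp only [walk, covWalkSum_cons]
    rw [(htail _ fun s hs => bond_ne_centreLeg_of_mem_walk_tail hj c i hν hw (by simp [walkEnd]) s hs)]
    by_cases ha : a = ν
    · subst ha
      rw [if_pos (hhead.mpr rfl)]
      simp [covStep]
    · have hne : (⟨emb c.src, a⟩ : PBond P j) ≠ ⟨emb c.src, ν⟩ := fun h => ha (PBond.mk.injEq _ _ _ _ ▸ h :).2
      have hif : ¬ (stairWord i.2.1 (off i.1)).head? = some (ν, true) := by rw [hhead]; simp [ha]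
      rw [if_neg hif]
      have : covStep U₀ Y ⟨⟨emb c.src, a⟩, true⟩ = 0 := by unfold covStep; rw [hY _ hne]; simp
      rw [this]; simp

/-- The straight line of `c` does not meet the centre leg `⟨emb c₋, ν⟩`, `ν ≠ c.dir`: its covariant sum vanishes. [folklore] -/
theorem covWalkSum_line_centreLeg (U₀ : GaugeField P j (Matrix.specialUnitaryGroup n ℂ)) (c : PBond P (j + 1)) {ν : Fin P.d}
    (hν : ν ≠ c.dir) {Y : PBond P j → Matrix n n ℂ} (hY : ∀ b, b ≠ ⟨emb c.src, ν⟩ → Y b = 0) :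
    covWalkSum U₀ Y (walk (emb c.src) (List.replicate P.L (c.dir, true))) = 0 := by
  refine covWalkSum_eq_zero_of_forall_bond_ne U₀ hY _ fun s hs h => ?_
  have hmem := BlockAveragingHaarAC.letter_mem_of_mem_walk _ _ s hs
  rw [List.mem_replicate] at hmem
  have : s.bond.dir = c.dir := (Prod.mk.injEq _ _ _ _ ▸ hmem.2 :).1
  rw [h] at this
  exact hν this

/-- **THE LINEARISED (0.4) AVERAGE OF A CENTRE-LEG PERTURBATION IS A SCALAR MULTIPLE OF IT**: `(Q₁(U₀)Y)(c) = (s′∕|I|)·Y(⟨emb c₋, ν⟩)`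
with `s′` the number of members whose staircase starts with `+e_ν` — NO transport by the background enters. [cite: Balaban1985Averaging, (124) p.36] -/
theorem covLinAvg_centreLeg (hj : j + 1 ≤ P.m + P.K) (U₀ : GaugeField P j (Matrix.specialUnitaryGroup n ℂ))
    (c : PBond P (j + 1)) {ν : Fin P.d} (hν : ν ≠ c.dir) {Y : PBond P j → Matrix n n ℂ}
    (hY : ∀ b, b ≠ ⟨emb c.src, ν⟩ → Y b = 0) :
    covLinAvg U₀ Y c =
      (((Fintype.card (Idx P) : ℂ))⁻¹ *
          ((Finset.univ.filter fun i : Idx P => (stairWord i.2.1 (off i.1)).head? = some (ν, true)).card : ℂ)) •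
        Y ⟨emb c.src, ν⟩ := by
  classical
  rw [covLinAvg_def, covWalkSum_line_centreLeg U₀ c hν hY, add_zero]
  simp_rw [covWalkSum_loopWord_centreLeg hj U₀ c hν hY]
  rw [Finset.sum_ite, Finset.sum_const_zero, add_zero, Finset.sum_const, mul_smul, ← Nat.cast_smul_eq_nsmul ℂ]

end CovSums

/-! ## §2 The first-order response of the (0.4) average to the centre leg -/

section Response

open BlockAveragingEMLLinearised BlockAveragingEMLLinearisedBackground ExpMeanLog

variable {P : Params} {j : ℕ}

variable {n : Type*} [Fintype n] [DecidableEq n] [DecidableEq (PBond P j)]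

/-- **THE PERTURBATION VARIABLE OF A CENTRE-LEG UPDATE** `U = U₀` off `e`, `U(e) = g·U₀(e)`: `Y_e = g − 1`, `Y_b = 0` otherwise.
[cite: Balaban1985Variational, (15) p.280] -/
theorem pertVar_update_mul (U₀ : GaugeField P j (Matrix.specialUnitaryGroup n ℂ)) (e : PBond P j)
    (g : Matrix.specialUnitaryGroup n ℂ) (b : PBond P j) :
    pertVar U₀ (Function.update U₀ e (g * U₀ e)) b = if b = e then (g : Matrix n n ℂ) - 1 else 0 := by
  have hu : ∀ u : Matrix.specialUnitaryGroup n ℂ, (u : Matrix n n ℂ) * star (u : Matrix n n ℂ) = 1 :=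
    fun u => Unitary.mul_star_self_of_mem (Matrix.mem_specialUnitaryGroup_iff.1 u.2).1
  by_cases hb : b = e
  · subst hb
    rw [if_pos rfl, pertVar_eq, Function.update_self, Submonoid.coe_mul, mul_assoc, hu, mul_one]
  · rw [if_neg hb, pertVar_eq, Function.update_of_ne hb, hu, sub_self]

/-- **THE CENTRE-LEG RESPONSE OF THE (0.4) AVERAGE, TO FIRST ORDER** — [Balaban1985Averaging] Prop. 3 (122)–(124) at a
small-field background (`BlockAveragingEMLLinearisedBackground.norm_avgFun_ratio_sub_one_sub_covLinAvg_le`) specialised to a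
perturbation of the ONE bond `⟨emb c₋, ν⟩`, `ν ≠ c.dir`: if the (0.4) loop variables of `U₀` at `c` are within `α ≤ 1∕24` of `1` and
`U(⟨emb c₋, ν⟩) = g·U₀(⟨emb c₋, ν⟩)` with `‖g − 1‖ ≤ δ`, `48ℓδ ≤ 1`, `2ℓδ + α < δ_N` (`ℓ = (d+2)L`), then
`‖Ū(c)·Ū₀(c)* − 1 − (s′∕|I|)·(g − 1)‖ ≤ 400·ℓδ·(ℓδ + α)`, where `s′ ≥ 1` (`exists_centreLeg_member`) counts the members whose
staircase starts with `+e_ν`: the response is a SCALAR multiple of the perturbation up to the printed remainder — no background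
transport enters the main term. [cite: Balaban1985Averaging, Prop. 3 (122)-(124) p.36] -/
theorem centreLeg_response [Nonempty n] (hj : j + 1 ≤ P.m + P.K) (U₀ : GaugeField P j (Matrix.specialUnitaryGroup n ℂ))
    (c : PBond P (j + 1)) {ν : Fin P.d} (hν : ν ≠ c.dir) {α δ : ℝ} (hδ : 0 ≤ δ)
    (hα : ∀ i, dist1 (loopHol U₀ c i) ≤ α) (hα24 : α ≤ 1 / 24)
    (h48 : 48 * ((((P.d + 2) * P.L : ℕ) : ℝ) * δ) ≤ 1) (hN : 2 * ((((P.d + 2) * P.L : ℕ) : ℝ) * δ) + α < deltaSU n)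
    (g : Matrix.specialUnitaryGroup n ℂ) (hg : ‖(g : Matrix n n ℂ) - 1‖ ≤ δ) :
    ‖((avgFun (expMeanLogSU (n := n)) (Function.update U₀ ⟨emb c.src, ν⟩ (g * U₀ ⟨emb c.src, ν⟩)) c :
            Matrix.specialUnitaryGroup n ℂ) : Matrix n n ℂ) *
          star ((avgFun (expMeanLogSU (n := n)) U₀ c : Matrix.specialUnitaryGroup n ℂ) : Matrix n n ℂ) - 1 -
        (((Fintype.card (Idx P) : ℂ))⁻¹ *
            ((Finset.univ.filter fun i : Idx P => (stairWord i.2.1 (off i.1)).head? = some (ν, true)).card : ℂ)) •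
          ((g : Matrix n n ℂ) - 1)‖ ≤
      400 * ((((P.d + 2) * P.L : ℕ) : ℝ) * δ) * ((((P.d + 2) * P.L : ℕ) : ℝ) * δ + α) := by
  classical
  set U : GaugeField P j (Matrix.specialUnitaryGroup n ℂ) := Function.update U₀ ⟨emb c.src, ν⟩ (g * U₀ ⟨emb c.src, ν⟩) with hU
  have hY : ∀ b, ‖pertVar U₀ U b‖ ≤ δ := fun b => by
    rw [hU, pertVar_update_mul]
    by_cases hb : b = (⟨emb c.src, ν⟩ : PBond P j)
    · rw [if_pos hb]; exact hg
    · rw [if_neg hb, norm_zero]; exact hδ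
  have hY0 : ∀ b, b ≠ (⟨emb c.src, ν⟩ : PBond P j) → pertVar U₀ U b = 0 := fun b hb => by
    rw [hU, pertVar_update_mul, if_neg hb]
  have key := norm_avgFun_ratio_sub_one_sub_covLinAvg_le U₀ U hδ hY h48 c hα hα24 hN
  rw [covLinAvg_centreLeg hj U₀ c hν hY0, hU, pertVar_update_mul, if_pos rfl] at key
  exact key


end Response

end Summit.QuantumFields.YangMills.Theorems.FluctuationComparisonRegPrIntLS1aCentreLegResponse

end
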